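import Summits.Ventures.PercRepro.MSMinLostHalves

/-!
# THEOREM (MIN): the rigid case and the induction

Dossier proofs/MINE1-theoremS.md, Addendum 58. Let `D` be a down-set and `A` an up-set of the cube
`2^G` with `∅ ∉ A`, let `c ⊆ G` satisfy (H) — `c ∖ z ∈ D` and `c ∪ z ∉ D` for every minimal
`z ∈ A` — and let the excess `|D ∩ Ā| − |D ∩ A|` be exactly one. Then for every minimal `z ∈ A`
the only fibre over `2^{G∖z}` crossed by `D` is `c ∖ z` (`crossSet_eq_singleton`,
`card_crossSet_eq_one`): in the lane (Addendum 57 suppl. 8) this is (MIN), `exc_z = 1`, hence (A∩)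
and shape A of `SingCaseIResidue α`.

Proof by induction on `|G|` (`MinLostStmt`): Step 1 `z = G`; Step 2 every crossed fibre other
than `c ∖ z` is the «opposite» set `(G ∖ z) ∖ c` (the `c`-half at each `f ∉ z` satisfies the
induction hypothesis); Steps 3–4 (MSMinLostHalves.lean) reduce the case `{f} ∉ A`, `f ∉ z`, to the
independence reduction; Step 5, the rigid case `A = 2^G ∖ {s ⊊ z}` (`rigid_not_mem`), is settled by
counting: `exc = |{b ∈ D : b ⊊ z}| − |{b ∈ D : G ∖ z ⊊ b}|` (`exc_rigid`) and the injection
`b ↦ b ∩ z` misses `∅` and one more set (`card_filter_add_two_le`).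
-/

namespace PercRepro.MSTight

open Finset

variable {α : Type*} [DecidableEq α]

section Rigid

variable {G : Finset α} {A D : Finset (Finset α)} {c s z v w b : Finset α} {f g : α}

/-- In the rigid case (every singleton outside `z` is a member) the up-set is everything but the
proper subsets of `z`. -/
theorem rigid_eq (hA : IsUpperIn G A) (hz : IsMinIn A z)
    (hsing : ∀ f ∈ G, f ∉ z → {f} ∈ A) : A = G.powerset.filter (fun a => ¬ a ⊂ z) := by
  ext a
  rw [mem_filter, mem_powerset]
  constructor
  · intro ha
    refine ⟨hA.1 a ha, fun hlt => ?_⟩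
    have := hz.2 a ha (Finset.ssubset_def.1 hlt).1
    exact (Finset.ssubset_def.1 hlt).2 (this ▸ subset_refl a)
  · rintro ⟨haG, hlt⟩
    by_cases haz : a ⊆ z
    · have : a = z := by
        by_contra hne
        exact hlt (Finset.ssubset_iff_subset_ne.2 ⟨haz, hne⟩)
      rw [this]; exact hz.1
    · obtain ⟨f, hfa, hfz⟩ := not_subset.1 haz
      exact hA.2 {f} (hsing f (haG hfa) hfz) a (singleton_subset_iff.2 hfa) haG

/-- `G ∖ v ⊆ z ↔ G ∖ z ⊆ v` (both say `G ⊆ v ∪ z`). -/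
theorem sdiff_subset_iff_sdiff_subset : G \ v ⊆ z ↔ G \ z ⊆ v := by
  constructor
  · intro h x hx
    obtain ⟨hxG, hxz⟩ := mem_sdiff.1 hx
    by_contra hxv
    exact hxz (h (mem_sdiff.2 ⟨hxG, hxv⟩))
  · intro h x hx
    obtain ⟨hxG, hxv⟩ := mem_sdiff.1 hx
    by_contra hxz
    exact hxv (h (mem_sdiff.2 ⟨hxG, hxz⟩))

/-- Complementation in `G` reverses strict inclusion: `G ∖ v ⊂ z ↔ G ∖ z ⊂ v`. -/
theorem sdiff_ssubset_iff_sdiff_ssubset (hv : v ⊆ G) (hz : z ⊆ G) : G \ v ⊂ z ↔ G \ z ⊂ v := by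
  rw [Finset.ssubset_iff_subset_ne, Finset.ssubset_iff_subset_ne, sdiff_subset_iff_sdiff_subset]
  constructor
  · rintro ⟨h, hne⟩
    refine ⟨h, fun e => hne ?_⟩
    rw [← e, Finset.sdiff_sdiff_eq_self hz]
  · rintro ⟨h, hne⟩
    refine ⟨h, fun e => hne ?_⟩
    rw [← e, Finset.sdiff_sdiff_eq_self hv]

/-- The excess in the rigid case, by counting. -/
theorem exc_rigid (hD : IsLowerIn G D) (hA : IsUpperIn G A) (hzG : z ⊆ G)
    (hAeq : A = G.powerset.filter (fun a => ¬ a ⊂ z)) :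
    exc G D A = ((D.filter (fun b => b ⊂ z)).card : ℤ) - (D.filter (fun b => G \ z ⊂ b)).card := by
  have e1 : D ∩ A = D.filter (fun b => ¬ b ⊂ z) := by
    ext b
    rw [mem_inter, mem_filter, hAeq, mem_filter, mem_powerset]
    constructor
    · rintro ⟨hb, -, h⟩; exact ⟨hb, h⟩
    · rintro ⟨hb, h⟩; exact ⟨hb, hD.1 b hb, h⟩
  have e2 : D ∩ cofG G A = D.filter (fun b => ¬ G \ z ⊂ b) := by
    ext b
    rw [mem_inter, mem_filter]
    constructor
    · rintro ⟨hb, hbc⟩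
      refine ⟨hb, ?_⟩
      rw [mem_cofG_iff hA.1 (hD.1 b hb), hAeq, mem_filter] at hbc
      rw [← sdiff_ssubset_iff_sdiff_ssubset (hD.1 b hb) hzG]
      exact hbc.2
    · rintro ⟨hb, h⟩
      refine ⟨hb, ?_⟩
      rw [mem_cofG_iff hA.1 (hD.1 b hb), hAeq, mem_filter, mem_powerset]
      exact ⟨sdiff_subset, by rwa [sdiff_ssubset_iff_sdiff_ssubset (hD.1 b hb) hzG]⟩
  unfold exc
  rw [e1, e2]
  have c1 := card_filter_add_card_filter_not (s := D) (fun b => b ⊂ z)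
  have c2 := card_filter_add_card_filter_not (s := D) (fun b => G \ z ⊂ b)
  omega

/-- A set `b ⊆ G` above `G ∖ z` is `G ∖ z ∪ (b ∩ z)`. -/
theorem eq_sdiff_union_inter (hbG : b ⊆ G) (hlt : G \ z ⊆ b) : b = G \ z ∪ (b ∩ z) := by
  ext x
  simp only [mem_union, mem_sdiff, mem_inter]
  constructor
  · intro hx
    by_cases hxz : x ∈ z
    · exact Or.inr ⟨hx, hxz⟩
    · exact Or.inl ⟨hbG hx, hxz⟩
  · rintro (⟨hxG, hxz⟩ | ⟨hx, -⟩)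
    · exact hlt (mem_sdiff.2 ⟨hxG, hxz⟩)
    · exact hx

/-- The injection `b ↦ b ∩ z` from the sets strictly above `G ∖ z` into the proper subsets of `z`,
missing `∅` and a second set `w`. -/
theorem card_filter_add_two_le (hD : IsLowerIn G D) (hGD : G ∉ D) (hzD : z ∉ D)
    (hw : w ∈ D) (hwz : w ⊆ z) (hwne : w ≠ ∅) (hw' : G \ z ∪ w ∉ D) :
    (D.filter (fun b => G \ z ⊂ b)).card + 2 ≤ (D.filter (fun b => b ⊂ z)).card := by
  have hE : ∅ ∈ D := hD.2 (empty_subset w) hw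
  have hPE : ∅ ∈ D.filter (fun b => b ⊂ z) := by
    rw [mem_filter]
    refine ⟨hE, Finset.ssubset_iff_subset_ne.2 ⟨empty_subset z, fun h => hzD (h ▸ hE)⟩⟩
  have hPw : w ∈ D.filter (fun b => b ⊂ z) := by
    rw [mem_filter]
    exact ⟨hw, Finset.ssubset_iff_subset_ne.2 ⟨hwz, fun h => hzD (h ▸ hw)⟩⟩
  have hpair : ({∅, w} : Finset (Finset α)) ⊆ D.filter (fun b => b ⊂ z) := by
    intro x hx
    rcases mem_insert.1 hx with rfl | hx
    · exact hPE
    · rw [mem_singleton.1 hx]; exact hPw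
  have hmaps : ∀ b ∈ D.filter (fun b => G \ z ⊂ b), b ∩ z ∈ D.filter (fun b => b ⊂ z) \ {∅, w} := by
    intro b hb
    rw [mem_filter] at hb
    obtain ⟨hbD, hlt⟩ := hb
    have hbG := hD.1 b hbD
    have hlt' := Finset.ssubset_def.1 hlt
    rw [mem_sdiff, mem_filter, mem_insert, mem_singleton]
    refine ⟨⟨hD.2 inter_subset_left hbD, ?_⟩, ?_⟩
    · rw [Finset.ssubset_iff_subset_ne]
      refine ⟨inter_subset_right, fun h => hGD ?_⟩
      have hzb : z ⊆ b := by rw [← h]; exact inter_subset_left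
      have hGb : G ⊆ b := by
        intro x hx
        by_cases hxz : x ∈ z
        · exact hzb hxz
        · exact hlt'.1 (mem_sdiff.2 ⟨hx, hxz⟩)
      rwa [Subset.antisymm hbG hGb] at hbD
    · rintro (h | h)
      · apply hlt'.2
        intro x hx
        refine mem_sdiff.2 ⟨hbG hx, fun hxz => ?_⟩
        have : x ∈ b ∩ z := mem_inter.2 ⟨hx, hxz⟩
        rw [h] at this
        exact notMem_empty x this
      · apply hw'
        have := eq_sdiff_union_inter hbG hlt'.1
        rw [h] at this
        rw [← this]
        exact hbD
  have hinj : Set.InjOn (fun b => b ∩ z) ((D.filter (fun b => G \ z ⊂ b)) : Set (Finset α)) := by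
    intro b hb b' hb' he
    simp only at he
    rw [mem_coe, mem_filter] at hb hb'
    rw [eq_sdiff_union_inter (hD.1 b hb.1) (Finset.ssubset_def.1 hb.2).1, he,
      ← eq_sdiff_union_inter (hD.1 b' hb'.1) (Finset.ssubset_def.1 hb'.2).1]
  have hcard := card_le_card_of_injOn (fun b => b ∩ z) (fun b hb => hmaps b hb) hinj
  rw [card_sdiff_of_subset hpair, card_pair (Ne.symm hwne)] at hcard
  have := card_le_card hpair
  rw [card_pair (Ne.symm hwne)] at this
  omega

/-- Step 5, the rigid case: the «opposite» set `(G ∖ z) ∖ c` is not a crossed fibre. -/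
theorem rigid_not_mem (hD : IsLowerIn G D) (hA : IsUpperIn G A) (hc : c ⊆ G) (hH : HypH D A c)
    (h1 : exc G D A = 1) (hz : IsMinIn A z) (hzG : z ≠ G)
    (hsing : ∀ f ∈ G, f ∉ z → {f} ∈ A) : (G \ z) \ c ∉ crossSet D z := by
  intro hv
  have hzsub : z ⊆ G := hA.1 z hz.1
  obtain ⟨hvD, -, hvz⟩ := mem_crossSet.1 hv
  obtain ⟨hcz, hcz'⟩ := hH z hz
  have hGD : G ∉ D := fun h => hcz' (hD.2 (union_subset hc hzsub) h)
  have hexc := exc_rigid hD hA hzsub (rigid_eq hA hz hsing)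
  have hsingH : ∀ f ∈ G, f ∉ z → c \ {f} ∈ D ∧ c ∪ {f} ∉ D :=
    fun f hf hfz => hH.mem hD (hsing f hf hfz)
  obtain ⟨f₀, hf₀G, hf₀z⟩ : ∃ f ∈ G, f ∉ z :=
    exists_of_ssubset (Finset.ssubset_iff_subset_ne.2 ⟨hzsub, hzG⟩)
  by_cases hex : ∃ f ∈ G, f ∉ z ∧ f ∉ c
  · -- sub-case (a): `c ⊆ z`
    obtain ⟨f₁, hf₁G, hf₁z, hf₁c⟩ := hex
    obtain ⟨hc1, hc2⟩ := hsingH f₁ hf₁G hf₁z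
    have hcD : c ∈ D := by
      rwa [sdiff_singleton_eq_erase, erase_eq_of_notMem hf₁c] at hc1
    have hcsub : c ⊆ z := by
      intro x hxc
      by_contra hxz
      obtain ⟨-, h⟩ := hsingH x (hc hxc) hxz
      apply h
      rwa [union_eq_left.2 (singleton_subset_iff.2 hxc)]
    have hzD : z ∉ D := by
      rwa [union_eq_right.2 hcsub] at hcz'
    have hvD' : G \ z ∈ D := by
      have : (G \ z) \ c = G \ z := by
        rw [sdiff_eq_left]
        exact disjoint_of_subset_right hcsub disjoint_sdiff_self_left
      rwa [this] at hvD
    by_cases hcE : c = ∅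
    · apply hc2
      rw [hcE, empty_union]
      exact hD.2 (singleton_subset_iff.2 (mem_sdiff.2 ⟨hf₁G, hf₁z⟩)) hvD'
    · have hw' : G \ z ∪ c ∉ D := by
        intro h
        apply hc2
        refine hD.2 ?_ h
        exact union_subset subset_union_right
          (singleton_subset_iff.2 (mem_union_left _ (mem_sdiff.2 ⟨hf₁G, hf₁z⟩)))
      have := card_filter_add_two_le hD hGD hzD hcD hcsub hcE hw'
      omega
  · -- sub-case (b): `G ∖ z ⊆ c`
    have hGzc : G \ z ⊆ c := by
      intro x hx
      obtain ⟨hxG, hxz⟩ := mem_sdiff.1 hx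
      by_contra hxc
      exact hex ⟨x, hxG, hxz, hxc⟩
    have hvE : (G \ z) \ c = ∅ := sdiff_eq_empty_iff_subset.2 hGzc
    rw [hvE] at hvD hvz
    rw [empty_union] at hvz
    obtain ⟨hc1, hc2⟩ := hsingH f₀ hf₀G hf₀z
    have hf₀c : f₀ ∈ c := hGzc (mem_sdiff.2 ⟨hf₀G, hf₀z⟩)
    have hcD : c ∉ D := by
      rwa [union_eq_left.2 (singleton_subset_iff.2 hf₀c)] at hc2
    have hceq : G \ z ∪ (c ∩ z) = c := by
      ext x
      simp only [mem_union, mem_sdiff, mem_inter]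
      constructor
      · rintro (h | ⟨h, -⟩)
        · exact hGzc (mem_sdiff.2 h)
        · exact h
      · intro hxc
        by_cases hxz : x ∈ z
        · exact Or.inr ⟨hxc, hxz⟩
        · exact Or.inl ⟨hc hxc, hxz⟩
    have hwD : c ∩ z ∈ D := by
      refine hD.2 ?_ hc1
      intro x hx
      obtain ⟨hxc, hxz⟩ := mem_inter.1 hx
      exact mem_sdiff.2 ⟨hxc, fun h => hf₀z ((mem_singleton.1 h) ▸ hxz)⟩
    have hwne : c ∩ z ≠ ∅ := by
      intro h
      rw [h, union_empty] at hceq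
      apply hcD
      rw [← hceq]
      have : c \ z = G \ z := by rw [← hceq, sdiff_eq_left]; exact disjoint_sdiff_self_left
      rwa [this] at hcz
    have hw' : G \ z ∪ (c ∩ z) ∉ D := by rwa [hceq]
    have := card_filter_add_two_le hD hGD hvz hwD inter_subset_right hwne hw'
    omega

end Rigid

section Main

variable {G : Finset α} {A D : Finset (Finset α)} {c z : Finset α}

/-- The base case of the induction: an empty ground set carries no up-set without `∅`. -/
theorem minLostStmt_zero : MinLostStmt α 0 := by
  intro G D A c hG hD hA hE hc hH h1 z hz
  have hG0 : G = ∅ := card_eq_zero.1 (Nat.le_zero.1 hG)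
  have hzsub := hA.1 z hz.1
  rw [hG0, subset_empty] at hzsub
  exact absurd (hzsub ▸ hz.1) hE

/-- The inductive step of THEOREM (MIN), Addendum 58 Steps 1–5. -/
theorem minLostStmt_succ {n : ℕ} (ih : MinLostStmt α n) : MinLostStmt α (n + 1) := by
  intro G D A c hG hD hA hE hc hH h1 z hz
  have hzsub : z ⊆ G := hA.1 z hz.1
  have hcz := hH.sdiff_mem_crossSet hz
  by_cases hzG : z = G
  · subst hzG
    ext v
    rw [mem_singleton, mem_crossSet]
    constructor
    · rintro ⟨hv, hdisj, -⟩
      have hvE : v = ∅ := by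
        rw [← subset_empty]
        intro x hx
        exact absurd (hD.1 v hv hx) (disjoint_left.1 hdisj hx)
      rw [hvE, sdiff_eq_empty_iff_subset.2 hc]
    · rintro rfl
      exact mem_crossSet.1 hcz
  · -- Step 2
    have step2 : ∀ v ∈ crossSet D z, v ≠ c \ z → v = (G \ z) \ c := by
      intro v hv hne
      obtain ⟨hvD, hdisj, hvz⟩ := mem_crossSet.1 hv
      have hvG := hD.1 v hvD
      have key : ∀ f ∈ G, f ∉ z → ¬ (f ∈ v ↔ f ∈ c) := by
        intro f hf hfz hvc
        apply hne
        have hG' : (G.erase f).card ≤ n := by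
          rw [card_erase_of_mem hf]; omega
        have hE' : ∅ ∉ A.nonMemberSubfamily f := fun h => hE (mem_nonMemberSubfamily.1 h).1
        have hface := ih (G.erase f) (halfOf D c f) (A.nonMemberSubfamily f) (c.erase f) hG'
          (isLowerIn_halfOf hD) (isUpperIn_nonMember hA) hE' (erase_subset_erase f hc)
          hH.halfOf (exc_halfOf_eq_one hD hA hH h1 hf hz hfz) z (isMinIn_nonMember hz hfz)
        have hmem : v.erase f ∈ crossSet (halfOf D c f) z := by
          rw [mem_crossSet]
          refine ⟨(erase_mem_halfOf_iff hvc).2 hvD,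
            disjoint_of_subset_left (erase_subset f v) hdisj, ?_⟩
          intro h
          rw [mem_halfOf] at h
          obtain ⟨-, h⟩ := h
          split_ifs at h with hfc
          · rw [insert_erase_union (hvc.2 hfc)] at h
            exact hvz h
          · rw [erase_eq_of_notMem (fun h' => hfc (hvc.1 h'))] at h
            exact hvz h
        rw [hface, mem_singleton] at hmem
        ext x
        by_cases hxf : x = f
        · subst hxf
          simp only [mem_sdiff]
          constructor
          · intro hx; exact ⟨hvc.1 hx, hfz⟩
          · rintro ⟨hx, -⟩; exact hvc.2 hx
        · have e1 : x ∈ v ↔ x ∈ v.erase f := by simp [hxf]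
          have e2 : x ∈ c \ z ↔ x ∈ c.erase f \ z := by simp [hxf]
          rw [e1, hmem, e2]
      ext x
      simp only [mem_sdiff]
      constructor
      · intro hx
        have hxG := hvG hx
        have hxz : x ∉ z := fun h => disjoint_left.1 hdisj hx h
        exact ⟨⟨hxG, hxz⟩, fun hxc => key x hxG hxz ⟨fun _ => hxc, fun _ => hx⟩⟩
      · rintro ⟨⟨hxG, hxz⟩, hxc⟩
        by_contra hxv
        exact key x hxG hxz ⟨fun h => absurd h hxv, fun h => absurd h hxc⟩
    apply Subset.antisymm
    · intro v hv
      rw [mem_singleton]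
      by_contra hne
      have hv' := step2 v hv hne
      rw [hv'] at hv hne
      by_cases hsing : ∀ f ∈ G, f ∉ z → {f} ∈ A
      · exact rigid_not_mem hD hA hc hH h1 hz hzG hsing hv
      · have hex : ∃ f ∈ G, f ∉ z ∧ {f} ∉ A := by
          by_contra h
          apply hsing
          intro f hf hfz
          by_contra hfA
          exact h ⟨f, hf, hfz, hfA⟩
        obtain ⟨f, hf, hfz, hfA⟩ := hex
        have hvc : f ∈ (G \ z) \ c ↔ f ∉ c := by simp [hf, hfz]
        obtain ⟨h00, h10⟩ := exc_both_halves_eq_one hD hA hH h1 hf hz hfz hv hvc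
        obtain ⟨h01, h11⟩ := exc_halves_member_eq_zero hD hA h1 hf h00 h10
        have hzA1 : z ∈ A.memberSubfamily f :=
          mem_memberSubfamily.2 ⟨hA.2 z hz.1 (insert f z) (subset_insert f z)
            (insert_subset hf hzsub), hfz⟩
        obtain ⟨m, hm, hmz⟩ := exists_isMinIn_subset hzA1
        have hmne : m.Nonempty := by
          rw [nonempty_iff_ne_empty]
          rintro rfl
          apply hfA
          have := (mem_memberSubfamily.1 hm.1).1
          rwa [insert_empty] at this
        have hfm : f ∉ m := fun h => hfz (hmz h)
        have hcl := union_mem_of_crossSet_halves_eq_empty hD hfm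
          (crossSet_eq_empty_of_exc_eq_zero (isLowerIn_nonMember hD) (isUpperIn_member hf hA) hm h01)
          (crossSet_eq_empty_of_exc_eq_zero (isLowerIn_member hD) (isUpperIn_member hf hA) hm h11)
        obtain ⟨g, hg⟩ := hmne
        have hind := insert_mem_of_union_mem hD hcl hg
        have hgz : g ∈ z := hmz hg
        have := crossSet_eq_of_indep ih hG hD hA hc hH h1 hz hgz hind
        rw [this, mem_singleton] at hv
        exact hne hv
    · rw [singleton_subset_iff]
      exact hcz

/-- THEOREM (MIN) for every size of the ground set, by induction. -/
theorem minLostStmt : ∀ n : ℕ, MinLostStmt α n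
  | 0 => minLostStmt_zero
  | n + 1 => minLostStmt_succ (minLostStmt n)

/-- **THEOREM (MIN)** (Addendum 58). Let `D` be a down-set and `A` an up-set of the cube `2^G` with
`∅ ∉ A`, let `c ⊆ G` satisfy (H): `c ∖ z ∈ D` and `c ∪ z ∉ D` for every minimal `z ∈ A`, and let the
excess `|D ∩ Ā| − |D ∩ A|` be exactly one. Then for every minimal `z ∈ A` the only fibre over
`2^{G∖z}` crossed by `D` is `c ∖ z`: `{v ∈ D : v ∩ z = ∅, v ∪ z ∉ D} = {c ∖ z}`. -/
theorem crossSet_eq_singleton (hD : IsLowerIn G D) (hA : IsUpperIn G A) (hE : ∅ ∉ A) (hc : c ⊆ G)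
    (hH : HypH D A c) (h1 : exc G D A = 1) (hz : IsMinIn A z) : crossSet D z = {c \ z} :=
  minLostStmt G.card G D A c le_rfl hD hA hE hc hH h1 z hz

/-- The crossed-fibre count of a minimal member is one. -/
theorem card_crossSet_eq_one (hD : IsLowerIn G D) (hA : IsUpperIn G A) (hE : ∅ ∉ A) (hc : c ⊆ G)
    (hH : HypH D A c) (h1 : exc G D A = 1) (hz : IsMinIn A z) : (crossSet D z).card = 1 := by
  rw [crossSet_eq_singleton hD hA hE hc hH h1 hz, card_singleton]

end Main

end PercRepro.MSTight
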